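import Mathlib

/-!
# Conference matrices: the Delsarte–Goethals–Seidel SYMMETRISATION theorem in the kernel (any order), and its reading at
# order 334 (row F11 of the H(668) census)

Framing: lottery ticket; floor = certified bounds/negative ranges.  Cell pub-namedobj (venture DiscreteObjects),
target (H), hadamard gen 27.  PRINT STATUS: KNOWN THEOREM — Delsarte–Goethals–Seidel, *Orthogonal matrices with zero
diagonal II*, Canad. J. Math. 23 (1971); Brouwer–Haemers, *Spectra of Graphs* (2012), Lemma 10.4.1: "Let `S` be a
conference matrix of order `n > 2`.  Then `n` is even and one can find diagonal `±1` matrices `D, E` with `(DSE)ᵀ = DSE`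
iff `n ≡ 2 (mod 4)`; with `(DSE)ᵀ = −DSE` iff `n ≡ 0 (mod 4)`."  The kernel proof below is OURS and replaces the
four-way count of the textbook proof by one congruence: after normalising row `o` to `1` and column `o` to `α = ±1`,
for core indices `i ≠ j` the sum `T = Σ_k (1 + S_ik)(1 + S_jk)` equals `n + 2α` (row sums `α`, rows orthogonal) and is
`≡ 2 + S_ij + S_ji (mod 4)` termwise, whence **`S_ij + S_ji ≡ n (mod 4)`** (`key_congruence`).  A conference matrix is
given by explicit hypotheses (`hdiag : C i i = 0`, `hoff : C i j = ±1 (i ≠ j)`, `hC : C Cᵀ = (n − 1)·I`); no new `def`.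
* `conference_inner`, `conference_signing` (row/column signings preserve the three hypotheses);
* `key_congruence`; `exists_symm_signing_of_mod_four_eq_two` (**`n ≡ 2 (mod 4)` ⇒ some signing `D C E` is SYMMETRIC**),
  `exists_skew_signing_of_mod_four_eq_zero` (**`n ≡ 0 (mod 4)` ⇒ some signing is SKEW**);
  `mod_four_eq_two_of_symm` / `mod_four_eq_zero_of_skew` (the converses, `n > 2`), `even_card_of_conference` (`n ≠ 1`);
* order `334 ≡ 2 (mod 4)`: **`conference334_symm_signing` — every `C(334)` is sign-equivalent to a SYMMETRIC conference
  matrix** (so the classical symmetric doubling, and the `2C` symmetric searches, lose nothing), **`no_skew_conference334`**;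
  and the normal form / core reading `conference_core_identities`: the symmetric normalised `C(334)` has a core `S` on `333`
  points with zero row sums and `S Sᵀ = 333·I − J` off the diagonal bookkeeping (`Σ_{k ≠ o} S_ik S_jk = 333[i = j] − 1`),
  i.e. the Seidel matrix of a conference graph `srg(333, 166, 82, 83)` — another named open object equivalent to `C(334)`.
WORDS: replication (known theorem, our proof) + dictionary line; no order excluded; `C(334)`, `H(668)` untouched.  No `sorry`.
-/

namespace Summit.Ventures.DiscreteObjects.Hadamard

open Finset BigOperators Matrix

variable {ι : Type*} [Fintype ι] [DecidableEq ι]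

/-! ## §1 Inner products and signings -/

/-- rows of a conference matrix: `Σ_k C_ik C_jk = (n − 1)[i = j]`. -/
theorem conference_inner {C : Matrix ι ι ℤ} (hC : C * Cᵀ = ((Fintype.card ι : ℤ) - 1) • (1 : Matrix ι ι ℤ))
    (i j : ι) : ∑ k, C i k * C j k = if i = j then (Fintype.card ι : ℤ) - 1 else 0 := by
  have e := congrFun (congrFun hC i) j
  rw [Matrix.mul_apply] at e
  simpa [Matrix.transpose_apply, Matrix.smul_apply, Matrix.one_apply] using e

/-- a product of `±1` values is `±1` (private: the public statement exists elsewhere in the tree). -/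
private lemma pm_mul_pm {a b : ℤ} (ha : a = 1 ∨ a = -1) (hb : b = 1 ∨ b = -1) : a * b = 1 ∨ a * b = -1 := by
  rcases ha with rfl | rfl <;> rcases hb with rfl | rfl <;> norm_num

/-- **signing rows and columns preserves the conference hypotheses**: for `±1` vectors `d, e` the matrix
`(i, j) ↦ d_i C_ij e_j` again has zero diagonal, `±1` off the diagonal, and Gram matrix `(n − 1)·I`. -/
theorem conference_signing {C : Matrix ι ι ℤ} (hdiag : ∀ i, C i i = 0) (hoff : ∀ i j, i ≠ j → C i j = 1 ∨ C i j = -1)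
    (hC : C * Cᵀ = ((Fintype.card ι : ℤ) - 1) • (1 : Matrix ι ι ℤ)) {d e : ι → ℤ} (hd : ∀ i, d i = 1 ∨ d i = -1)
    (he : ∀ j, e j = 1 ∨ e j = -1) :
    (∀ i, (Matrix.of fun i j => d i * C i j * e j) i i = 0) ∧
    (∀ i j, i ≠ j → (Matrix.of fun i j => d i * C i j * e j) i j = 1 ∨ (Matrix.of fun i j => d i * C i j * e j) i j = -1) ∧
    (Matrix.of fun i j => d i * C i j * e j) * (Matrix.of fun i j => d i * C i j * e j)ᵀ =
      ((Fintype.card ι : ℤ) - 1) • (1 : Matrix ι ι ℤ) := by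
  refine ⟨fun i => by simp [hdiag], fun i j hij => ?_, ?_⟩
  · simp only [Matrix.of_apply]; exact pm_mul_pm (pm_mul_pm (hd i) (hoff i j hij)) (he j)
  · ext i j
    rw [Matrix.mul_apply, Matrix.smul_apply, Matrix.one_apply, smul_eq_mul]
    have hterm : ∀ k, (Matrix.of fun i j => d i * C i j * e j) i k * (Matrix.of fun i j => d i * C i j * e j)ᵀ k j =
        d i * d j * (C i k * C j k) := by
      intro k
      simp only [Matrix.of_apply, Matrix.transpose_apply]
      have hek : e k * e k = 1 := by rcases he k with h | h <;> rw [h] <;> norm_num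
      linear_combination d i * d j * C i k * C j k * hek
    rw [Finset.sum_congr rfl (fun k _ => hterm k), ← Finset.mul_sum, conference_inner hC]
    by_cases hij : i = j
    · subst hij
      have hdi : d i * d i = 1 := by rcases hd i with h | h <;> rw [h] <;> norm_num
      rw [if_pos rfl, if_pos rfl, hdi, one_mul, mul_one]
    · rw [if_neg hij, if_neg hij, mul_zero, mul_zero]

/-! ## §2 The key congruence for a normalised conference matrix -/

/-- `(1 + u)(1 + v)` is divisible by `4` for `u, v ∈ {±1}`. -/
lemma four_dvd_one_add_mul {u v : ℤ} (hu : u = 1 ∨ u = -1) (hv : v = 1 ∨ v = -1) : (4 : ℤ) ∣ (1 + u) * (1 + v) := by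
  rcases hu with rfl | rfl <;> rcases hv with rfl | rfl <;> norm_num

/-- **Key congruence.**  Let `S` be a conference matrix normalised at `o`: `S_oj = 1 (j ≠ o)` and `S_io = α (i ≠ o)`,
`α = ±1`.  Then for core indices `i ≠ j`: **`S_ij + S_ji ≡ n (mod 4)`**. -/
theorem key_congruence {S : Matrix ι ι ℤ} (hdiag : ∀ i, S i i = 0) (hoff : ∀ i j, i ≠ j → S i j = 1 ∨ S i j = -1)
    (hS : S * Sᵀ = ((Fintype.card ι : ℤ) - 1) • (1 : Matrix ι ι ℤ)) (o : ι) {α : ℤ} (hα : α = 1 ∨ α = -1)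
    (hrow : ∀ j, j ≠ o → S o j = 1) (hcol : ∀ i, i ≠ o → S i o = α) {i j : ι} (hij : i ≠ j) (hio : i ≠ o)
    (hjo : j ≠ o) : (4 : ℤ) ∣ (Fintype.card ι : ℤ) - (S i j + S j i) := by
  -- row sums of core rows are `α`
  have hrs : ∀ i, i ≠ o → ∑ k, S i k = α := by
    intro i hio
    have h0 := conference_inner hS i o
    rw [if_neg hio] at h0
    have hsplit : ∀ k, S i k * S o k = S i k - (if k = o then S i k else 0) := by
      intro k; by_cases hk : k = o
      · subst hk; rw [hdiag, if_pos rfl]; ring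
      · rw [hrow k hk, if_neg hk]; ring
    rw [Finset.sum_congr rfl (fun k _ => hsplit k), Finset.sum_sub_distrib, Finset.sum_ite_eq' Finset.univ o,
      if_pos (Finset.mem_univ _), hcol i hio] at h0
    linarith
  -- the sum `T`
  set f : ι → ℤ := fun k => (1 + S i k) * (1 + S j k) with hf
  have hT : ∑ k, f k = (Fintype.card ι : ℤ) + 2 * α := by
    have e : ∀ k, f k = 1 + S i k + S j k + S i k * S j k := fun k => by rw [hf]; ring
    rw [Finset.sum_congr rfl (fun k _ => e k), Finset.sum_add_distrib, Finset.sum_add_distrib, Finset.sum_add_distrib,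
      Finset.sum_const, Finset.card_univ, hrs i hio, hrs j hjo, conference_inner hS i j, if_neg hij]
    simp; ring
  -- termwise divisibility off `{i, j}`
  have hdvd : ∀ k ∈ (Finset.univ.erase i).erase j, (4 : ℤ) ∣ f k := by
    intro k hk
    rw [Finset.mem_erase, Finset.mem_erase] at hk
    exact four_dvd_one_add_mul (hoff i k (Ne.symm hk.2.1)) (hoff j k (Ne.symm hk.1))
  have hsum : ∑ k, f k = f i + f j + ∑ k ∈ (Finset.univ.erase i).erase j, f k := by
    rw [← Finset.add_sum_erase _ _ (Finset.mem_univ i), ← Finset.add_sum_erase _ _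
      (Finset.mem_erase.mpr ⟨Ne.symm hij, Finset.mem_univ j⟩), add_assoc]
  have hfi : f i = 1 + S j i := by rw [hf]; simp only; rw [hdiag]; ring
  have hfj : f j = 1 + S i j := by rw [hf]; simp only; rw [hdiag]; ring
  have h4 : (4 : ℤ) ∣ ∑ k ∈ (Finset.univ.erase i).erase j, f k := Finset.dvd_sum hdvd
  have hα4 : (4 : ℤ) ∣ 2 * α - 2 := by rcases hα with rfl | rfl <;> norm_num
  have e : (Fintype.card ι : ℤ) - (S i j + S j i) = (∑ k ∈ (Finset.univ.erase i).erase j, f k) - (2 * α - 2) := by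
    linarith [hT, hsum, hfi, hfj]
  rw [e]; exact dvd_sub h4 hα4

/-- reading the congruence on `±1` values: `n ≡ 2 (mod 4)` forces `u = v`, `n ≡ 0 (mod 4)` forces `u = −v`, and `n` is even. -/
lemma pm_congruence {n u v : ℤ} (hu : u = 1 ∨ u = -1) (hv : v = 1 ∨ v = -1) (h : (4 : ℤ) ∣ n - (u + v)) :
    (n % 4 = 2 → u = v) ∧ (n % 4 = 0 → u = -v) ∧ n % 2 = 0 := by
  rcases hu with rfl | rfl <;> rcases hv with rfl | rfl <;> omega

/-! ## §3 Symmetric and skew signings (Delsarte–Goethals–Seidel / Brouwer–Haemers Lemma 10.4.1) -/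

omit [Fintype ι] in
/-- the normalising signing at `o` with column value `α` (`d_i = α C_io`, `e_j = C_oj` off `o`, `d_o = e_o = 1`): the
vectors are `±1`, the signed matrix has row `o` equal to `1` and column `o` equal to `α` off the diagonal. -/
lemma normalising_signing {C : Matrix ι ι ℤ} (hoff : ∀ i j, i ≠ j → C i j = 1 ∨ C i j = -1) (o : ι) {α : ℤ}
    (hα : α = 1 ∨ α = -1) :
    (∀ i, (if i = o then (1 : ℤ) else α * C i o) = 1 ∨ (if i = o then (1 : ℤ) else α * C i o) = -1) ∧
    (∀ j, (if j = o then (1 : ℤ) else C o j) = 1 ∨ (if j = o then (1 : ℤ) else C o j) = -1) ∧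
    (∀ j, j ≠ o → (Matrix.of fun i j => (if i = o then (1 : ℤ) else α * C i o) * C i j *
      (if j = o then (1 : ℤ) else C o j)) o j = 1) ∧
    (∀ i, i ≠ o → (Matrix.of fun i j => (if i = o then (1 : ℤ) else α * C i o) * C i j *
      (if j = o then (1 : ℤ) else C o j)) i o = α) := by
  refine ⟨fun i => ?_, fun j => ?_, fun j hj => ?_, fun i hi => ?_⟩
  · by_cases hi : i = o
    · rw [if_pos hi]; exact Or.inl rfl
    · rw [if_neg hi]; exact pm_mul_pm hα (hoff i o hi)
  · by_cases hj : j = o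
    · rw [if_pos hj]; exact Or.inl rfl
    · rw [if_neg hj]; exact hoff o j (Ne.symm hj)
  · rw [Matrix.of_apply, if_pos rfl, if_neg hj, one_mul]
    rcases hoff o j (Ne.symm hj) with h | h <;> rw [h] <;> norm_num
  · rw [Matrix.of_apply, if_neg hi, if_pos rfl, mul_one]
    have h2 : C i o * C i o = 1 := by rcases hoff i o hi with h | h <;> rw [h] <;> norm_num
    linear_combination α * h2

/-- **DGS, `n ≡ 2 (mod 4)`: a symmetric signing exists.**  For a conference matrix `C` of order `n ≡ 2 (mod 4)` there
are `±1` vectors `d, e` such that the signed matrix `S = (d_i C_ij e_j)` is SYMMETRIC (and again a conference matrix,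
`conference_signing`). -/
theorem exists_symm_signing_of_mod_four_eq_two {C : Matrix ι ι ℤ} (hdiag : ∀ i, C i i = 0)
    (hoff : ∀ i j, i ≠ j → C i j = 1 ∨ C i j = -1) (hC : C * Cᵀ = ((Fintype.card ι : ℤ) - 1) • (1 : Matrix ι ι ℤ))
    (hn : Fintype.card ι % 4 = 2) :
    ∃ d e : ι → ℤ, (∀ i, d i = 1 ∨ d i = -1) ∧ (∀ j, e j = 1 ∨ e j = -1) ∧
      ∀ i j, (Matrix.of fun i j => d i * C i j * e j) i j = (Matrix.of fun i j => d i * C i j * e j) j i := by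
  have hne : Nonempty ι := Fintype.card_pos_iff.mp (by omega)
  obtain ⟨o⟩ := hne
  obtain ⟨hd, he, hrow, hcol⟩ := normalising_signing hoff o (α := 1) (Or.inl rfl)
  obtain ⟨hSd, hSo, hSg⟩ := conference_signing hdiag hoff hC hd he
  refine ⟨_, _, hd, he, fun i j => ?_⟩
  by_cases hij : i = j
  · rw [hij]
  by_cases hio : i = o
  · have hjo : j ≠ o := fun h => hij (hio.trans h.symm)
    rw [hio, hrow j hjo, hcol j hjo]
  by_cases hjo : j = o
  · rw [hjo, hrow i hio, hcol i hio]
  have key := key_congruence hSd hSo hSg o (Or.inl rfl) hrow hcol hij hio hjo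
  have hn' : (Fintype.card ι : ℤ) % 4 = 2 := by exact_mod_cast hn
  exact (pm_congruence (hSo i j hij) (hSo j i (Ne.symm hij)) key).1 hn'

/-- **DGS, `n ≡ 0 (mod 4)`: a skew signing exists** (`S_ij = −S_ji` for all `i, j`). -/
theorem exists_skew_signing_of_mod_four_eq_zero {C : Matrix ι ι ℤ} (hdiag : ∀ i, C i i = 0)
    (hoff : ∀ i j, i ≠ j → C i j = 1 ∨ C i j = -1) (hC : C * Cᵀ = ((Fintype.card ι : ℤ) - 1) • (1 : Matrix ι ι ℤ))
    (hn : Fintype.card ι % 4 = 0) :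
    ∃ d e : ι → ℤ, (∀ i, d i = 1 ∨ d i = -1) ∧ (∀ j, e j = 1 ∨ e j = -1) ∧
      ∀ i j, (Matrix.of fun i j => d i * C i j * e j) i j = -(Matrix.of fun i j => d i * C i j * e j) j i := by
  rcases isEmpty_or_nonempty ι with hι | ⟨⟨o⟩⟩
  · exact ⟨fun _ => 1, fun _ => 1, fun i => (IsEmpty.false i).elim, fun j => (IsEmpty.false j).elim,
      fun i => (IsEmpty.false i).elim⟩
  obtain ⟨hd, he, hrow, hcol⟩ := normalising_signing hoff o (α := -1) (Or.inr rfl)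
  obtain ⟨hSd, hSo, hSg⟩ := conference_signing hdiag hoff hC hd he
  refine ⟨_, _, hd, he, fun i j => ?_⟩
  by_cases hij : i = j
  · rw [hij, hSd j]; norm_num
  by_cases hio : i = o
  · have hjo : j ≠ o := fun h => hij (hio.trans h.symm)
    rw [hio, hrow j hjo, hcol j hjo]; norm_num
  by_cases hjo : j = o
  · rw [hjo, hrow i hio, hcol i hio]
  have key := key_congruence hSd hSo hSg o (Or.inr rfl) hrow hcol hij hio hjo
  have hn' : (Fintype.card ι : ℤ) % 4 = 0 := by exact_mod_cast hn
  exact (pm_congruence (hSo i j hij) (hSo j i (Ne.symm hij)) key).2.1 hn'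

/-! ## §4 The converses and evenness -/

/-- the congruence read on three distinct indices of `C` itself when `C` is symmetric (`α = 1`) or skew (`α = −1`):
with the normalising signing `d = e`, the two signed entries are `u` and `α u`, so `4 ∣ n − (1 + α)`. -/
theorem mod_four_of_three {C : Matrix ι ι ℤ} (hdiag : ∀ i, C i i = 0) (hoff : ∀ i j, i ≠ j → C i j = 1 ∨ C i j = -1)
    (hC : C * Cᵀ = ((Fintype.card ι : ℤ) - 1) • (1 : Matrix ι ι ℤ)) {α : ℤ} (hα : α = 1 ∨ α = -1)
    (hsym : ∀ i j, C j i = α * C i j) {o i j : ι} (hij : i ≠ j) (hio : i ≠ o) (hjo : j ≠ o) :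
    (4 : ℤ) ∣ (Fintype.card ι : ℤ) - (1 + α) := by
  obtain ⟨hd, he, hrow, hcol⟩ := normalising_signing hoff o hα
  obtain ⟨hSd, hSo, hSg⟩ := conference_signing hdiag hoff hC hd he
  have key := key_congruence hSd hSo hSg o hα hrow hcol hij hio hjo
  have hαsq : α * α = 1 := by rcases hα with h | h <;> rw [h] <;> norm_num
  -- `d = e` entrywise
  have hde : ∀ k, (if k = o then (1 : ℤ) else α * C k o) = (if k = o then (1 : ℤ) else C o k) := by
    intro k; by_cases hk : k = o
    · rw [if_pos hk, if_pos hk]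
    · rw [if_neg hk, if_neg hk, hsym o k, ← mul_assoc, hαsq, one_mul]
  have hu := hSo i j hij
  have e2 : (Matrix.of fun i j => (if i = o then (1 : ℤ) else α * C i o) * C i j * (if j = o then (1 : ℤ) else C o j)) j i =
      α * (Matrix.of fun i j => (if i = o then (1 : ℤ) else α * C i o) * C i j * (if j = o then (1 : ℤ) else C o j)) i j := by
    rw [Matrix.of_apply, Matrix.of_apply, hsym i j, hde i, hde j]; ring
  rw [e2] at key
  rcases hu with h | h <;> rw [h] at key
  · simpa using key
  · have e3 : (Fintype.card ι : ℤ) - (1 + α) = (Fintype.card ι : ℤ) - (-1 + α * -1) - 2 * (1 + α) := by ring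
    rw [e3]; refine dvd_sub key ?_
    rcases hα with h' | h' <;> rw [h'] <;> norm_num

/-- **a symmetric conference matrix of order `n > 2` has `n ≡ 2 (mod 4)`.** -/
theorem mod_four_eq_two_of_symm {C : Matrix ι ι ℤ} (hdiag : ∀ i, C i i = 0)
    (hoff : ∀ i j, i ≠ j → C i j = 1 ∨ C i j = -1) (hC : C * Cᵀ = ((Fintype.card ι : ℤ) - 1) • (1 : Matrix ι ι ℤ))
    (hsym : ∀ i j, C j i = C i j) (hn : 2 < Fintype.card ι) : Fintype.card ι % 4 = 2 := by
  obtain ⟨o, i, j, hoi, hoj, hij⟩ := Fintype.two_lt_card_iff.mp hn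
  have h := mod_four_of_three hdiag hoff hC (α := 1) (Or.inl rfl) (fun i j => by rw [hsym, one_mul]) hij
    (Ne.symm hoi) (Ne.symm hoj)
  omega

/-- **a skew conference matrix of order `n > 2` has `n ≡ 0 (mod 4)`.** -/
theorem mod_four_eq_zero_of_skew {C : Matrix ι ι ℤ} (hdiag : ∀ i, C i i = 0)
    (hoff : ∀ i j, i ≠ j → C i j = 1 ∨ C i j = -1) (hC : C * Cᵀ = ((Fintype.card ι : ℤ) - 1) • (1 : Matrix ι ι ℤ))
    (hskew : ∀ i j, C j i = -C i j) (hn : 2 < Fintype.card ι) : Fintype.card ι % 4 = 0 := by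
  obtain ⟨o, i, j, hoi, hoj, hij⟩ := Fintype.two_lt_card_iff.mp hn
  have h := mod_four_of_three hdiag hoff hC (α := -1) (Or.inr rfl) (fun i j => by rw [hskew]; ring) hij
    (Ne.symm hoi) (Ne.symm hoj)
  omega

/-- **the order of a conference matrix is even, unless it is `1`** (the `1 × 1` zero matrix is a conference matrix). -/
theorem even_card_of_conference {C : Matrix ι ι ℤ} (hdiag : ∀ i, C i i = 0)
    (hoff : ∀ i j, i ≠ j → C i j = 1 ∨ C i j = -1) (hC : C * Cᵀ = ((Fintype.card ι : ℤ) - 1) • (1 : Matrix ι ι ℤ))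
    (h1 : Fintype.card ι ≠ 1) : Even (Fintype.card ι) := by
  by_cases hn : 2 < Fintype.card ι
  · obtain ⟨o, i, j, hoi, hoj, hij⟩ := Fintype.two_lt_card_iff.mp hn
    obtain ⟨hd, he, hrow, hcol⟩ := normalising_signing hoff o (α := 1) (Or.inl rfl)
    obtain ⟨hSd, hSo, hSg⟩ := conference_signing hdiag hoff hC hd he
    have key := key_congruence hSd hSo hSg o (Or.inl rfl) hrow hcol hij (Ne.symm hoi) (Ne.symm hoj)
    have h2 := (pm_congruence (hSo i j hij) (hSo j i (Ne.symm hij)) key).2.2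
    refine Nat.even_iff.mpr ?_
    omega
  · interval_cases h : Fintype.card ι
    · exact ⟨0, rfl⟩
    · exact absurd rfl h1
    · exact ⟨1, rfl⟩

/-! ## §5 Order 334: every `C(334)` is sign-equivalent to a symmetric one; no skew `C(334)`; the core -/

/-- **Row F11 normal form: every conference matrix of order `334` is equivalent, under row and column sign changes,
to a SYMMETRIC conference matrix of order `334`.** -/
theorem conference334_symm_signing (hι : Fintype.card ι = 334) {C : Matrix ι ι ℤ} (hdiag : ∀ i, C i i = 0)
    (hoff : ∀ i j, i ≠ j → C i j = 1 ∨ C i j = -1) (hC : C * Cᵀ = (333 : ℤ) • (1 : Matrix ι ι ℤ)) :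
    ∃ d e : ι → ℤ, (∀ i, d i = 1 ∨ d i = -1) ∧ (∀ j, e j = 1 ∨ e j = -1) ∧
      (∀ i j, (Matrix.of fun i j => d i * C i j * e j) i j = (Matrix.of fun i j => d i * C i j * e j) j i) ∧
      (∀ i, (Matrix.of fun i j => d i * C i j * e j) i i = 0) ∧
      (∀ i j, i ≠ j → (Matrix.of fun i j => d i * C i j * e j) i j = 1 ∨ (Matrix.of fun i j => d i * C i j * e j) i j = -1) ∧
      (Matrix.of fun i j => d i * C i j * e j) * (Matrix.of fun i j => d i * C i j * e j)ᵀ = (333 : ℤ) • 1 := by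
  have hC' : C * Cᵀ = ((Fintype.card ι : ℤ) - 1) • (1 : Matrix ι ι ℤ) := by rw [hC, hι]; norm_num
  obtain ⟨d, e, hd, he, hsym⟩ := exists_symm_signing_of_mod_four_eq_two hdiag hoff hC' (by rw [hι])
  obtain ⟨h1, h2, h3⟩ := conference_signing hdiag hoff hC' hd he
  exact ⟨d, e, hd, he, hsym, h1, h2, by rw [h3, hι]; norm_num⟩

/-- **no SKEW conference matrix of order `334`** (`334 ≡ 2 (mod 4)`; a skew `C(n)` would give the Hadamard matrix `C + I`
of order `n`, impossible at `334` anyway). -/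
theorem no_skew_conference334 (hι : Fintype.card ι = 334) {C : Matrix ι ι ℤ} (hdiag : ∀ i, C i i = 0)
    (hoff : ∀ i j, i ≠ j → C i j = 1 ∨ C i j = -1) (hC : C * Cᵀ = (333 : ℤ) • (1 : Matrix ι ι ℤ))
    (hskew : ∀ i j, C j i = -C i j) : False := by
  have hC' : C * Cᵀ = ((Fintype.card ι : ℤ) - 1) • (1 : Matrix ι ι ℤ) := by rw [hC, hι]; norm_num
  have h := mod_four_eq_zero_of_skew hdiag hoff hC' hskew (by rw [hι]; norm_num)
  rw [hι] at h; norm_num at h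

/-- **The core of a symmetric normalised conference matrix** (any order `n`): if `S_oj = S_jo = 1` for `j ≠ o`, then the
core rows have zero sums and `Σ_{k ≠ o} S_ik S_jk = (n − 1)[i = j] − 1` — for a symmetric `S` of order `334` this says that
the core is the Seidel matrix of a conference graph `srg(333, 166, 82, 83)`. -/
theorem conference_core_identities {S : Matrix ι ι ℤ} (hdiag : ∀ i, S i i = 0)
    (hS : S * Sᵀ = ((Fintype.card ι : ℤ) - 1) • (1 : Matrix ι ι ℤ)) (o : ι) (hrow : ∀ j, j ≠ o → S o j = 1)
    (hcol : ∀ i, i ≠ o → S i o = 1) {i j : ι} (hio : i ≠ o) (hjo : j ≠ o) :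
    (∑ k ∈ Finset.univ.erase o, S i k = 0) ∧
    (∑ k ∈ Finset.univ.erase o, S i k * S j k = (if i = j then (Fintype.card ι : ℤ) - 1 else 0) - 1) := by
  constructor
  · have h0 := conference_inner hS i o
    rw [if_neg hio, ← Finset.add_sum_erase _ _ (Finset.mem_univ o), hdiag, mul_zero, zero_add] at h0
    rw [← h0]
    exact Finset.sum_congr rfl (fun k hk => by rw [hrow k (Finset.mem_erase.mp hk).1, mul_one])
  · have h0 := conference_inner hS i j
    rw [← Finset.add_sum_erase _ _ (Finset.mem_univ o), hcol i hio, hcol j hjo, one_mul] at h0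
    linarith

end Summit.Ventures.DiscreteObjects.Hadamard
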